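import Summits.HodgeConjecture.CorCM.WeilFourfoldOfMarkmanPlane
import Summits.HodgeConjecture.HodgeConjecture.Theorems.Ring2AbelianAllOddTimesCurve
import Literature.AlgebraicGeometry.Motives.HyperbolicWeilTypeProduct
import HarnessLib

/-!
# COR-CM — the Weil SIXFOLD `B × E` of a CM fivefold and a CM elliptic curve: Weil type `(3,3)` from the type count,
# and the WHOLE Weil plane algebraic given Markman's hyperbolic-sixfold theorem (the split polarisation is ring 2's)

Cell `pub-hodgecm2` (COR-CM), seat b09 gen 18 (2026-08-21); count-neutral own lane DECIC-EB0 (lit-andre-3's prover-lane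
ask A6-R22); theorems only, no definition, no named fact, no `sorry`.  HONEST FRAMING: no case of the Hodge conjecture is
proved unconditionally; the algebraicity statement is CONDITIONAL on the displayed named fact
`HodgeTheory.Markman2025_weilClasses_algebraic_hyperbolicSixfold` (E. Markman, arXiv:2502.03415 Thm 1.5.1, UNREFEREED:
the Hodge–Weil classes of polarised abelian sixfolds of Weil type of discriminant `-1` are algebraic).

The sixfold twin of seat b24's fourfold file `CorCM/WeilFourfoldOfMarkmanPlane.lean` (`isWeilType_cmThreefold_biprod_cmCurve`,
Deligne 1982 §5 (c): a sum of CM types with constant total gives Weil type), on the PRODUCT `B.prod E` (fivefold first,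
the shape of ring 2's `Ring2.AbelianAll.weilClasses_algebraic_fivefold_prod_curve_of_markmanSixfolds`):

* `card_filter_comp_eq_five` — a complex embedding of a quadratic `k` has five extensions to a decic `K` along `i : k → K`;
* **`isWeilType_cmFivefold_prod_cmCurve`** — for realisations `B ⊨ (K; Ψ)` (`[K:ℚ] = 10`), `E ⊨ (k; Φ₀)` (`[k:ℚ] = 2`),
  `δ ∈ 𝓞_k` with `δ² = -d`, `0 < d`, and `φ = ι_B(iδ) × ι_E(δ)` on `B × E`: the TYPE COUNT
  `#{s ∈ Ψ : s ∘ i = τ} + [τ ∈ Φ₀] = 3` (all `τ : k → ℂ`) gives Weil type `(3, d)` — for `τ₊` with `τ₊(δ) = i√d` the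
  classes `fst^* v_s` (`s ∘ i = τ₊`) and `snd^* u_{τ₊}` are six independent `i√d`-eigenvectors of `φ^*` on `H¹(B × E)`
  whose Hodge types sum to `(3,3)` (`WeilFourfold.isWeilType_of_cupPowOne`);
* **`weilClassesOf_le_algebraicClasses_cmFivefold_prod_cmCurve_of_markmanSixfold`** — GIVEN Markman's theorem, the whole
  Weil plane `W_k(B × E) ⊗ ℂ` consists of algebraic classes: `B × E` is an ODD-dimensional factor times a curve, so some
  `K`-symmetrised weighted Segre class is HYPERBOLIC (ring 2, seat ab-weil-2: `Ring2.AbelianAll.isSplitWeilType_odd_prod_curve`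
  — the «factorwise rescaling» of Deligne LNM 900 §5 (c) / van Geemen 5.2–5.4 / Landherr, consumed through
  `weilClasses_algebraic_fivefold_prod_curve_of_markmanSixfolds`), and Weil type upgrades the pointwise statement to the
  complex plane (`IsWeilType.weilClassesOf_le_algebraicClasses`, van Geemen 4.9).
This is the input `hW` of `CorCM/DecicCurveFivefoldPowersTransfer.lean`.

## References
* [Markman2025SecantWeil] E. Markman, arXiv:2502.03415 (unrefereed), Thm 1.5.1 (`HodgeTheory/WeilClassesSixfolds.lean`).
* [Deligne1982HodgeCycles] P. Deligne (notes by J. S. Milne), LNM 900 (1982), §4 Prop. 4.4, §5 (c).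
* [vanGeemen1994HodgeAV] B. van Geemen, LNM 1594 (1994), 4.9–4.10, Lemma 5.2 (2)–(4), 5.4 and (5.4.1).
* [MoonenZarhin1999LowDim] B. Moonen, Yu. Zarhin, Math. Ann. 315 (1999), Thm. 0.1 (a) (`X × E_k`, product polarisations).
-/

noncomputable section

namespace Summit.HodgeConjecture.CorCM.DecicCurveFivefold

open CategoryTheory CategoryTheory.Limits NumberField
open Literature.AlgebraicGeometry Literature.AlgebraicGeometry.Motives Literature.AlgebraicGeometry.HodgeTheory
open Literature.AlgebraicGeometry.ComplexMultiplication (IsCMTypeRealisation)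
open Literature.AlgebraicTopology.SingularHomology
open Literature.NumberTheory.Automorphic.PicardCM (eigenline)
open Summit.HodgeConjecture.CorCM.AndreProductForm
  (exists_eigenbasis map_ι_apply_of_mem_eigenline isOfHodgeType_oneZero_of_mem isOfHodgeType_zeroOne_of_not_mem)
open Summit.HodgeConjecture.CorCM.WeilFourfold (comp_self_eq_neg_of_sq_eq_neg dim_eq_of_isCMTypeRealisation
  exists_apply_eq_I_mul_sqrt isWeilType_of_cupPowOne)

/-! ## §1 Extensions of a complex embedding along a degree-five extension of number fields -/

section Fibre

open scoped Classical

variable {K : Type} [Field K] [NumberField K] {k : Type} [Field k] [NumberField k]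

/-- **Each complex embedding of `k` has exactly five extensions to `K`** along a ring map `i : k → K` of number
fields of degrees `[k:ℚ] = 2`, `[K:ℚ] = 10`: the extensions of `τ` are the `k`-algebra maps `K →ₐ[k] ℂ` for the
structures `i`, `τ`, of which there are `[K:k] = 10/2 = 5` (Mathlib `AlgHom.card`, tower law). [folklore] -/
theorem card_filter_comp_eq_five (i : k →+* K) (h10 : Module.finrank ℚ K = 10) (h2 : Module.finrank ℚ k = 2)
    (τ : k →+* ℂ) :
    (Finset.univ.filter fun s : K →+* ℂ => s.comp i = τ).card = 5 := by
  classical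
  letI : Algebra k K := i.toAlgebra
  letI : Algebra k ℂ := τ.toAlgebra
  haveI : IsScalarTower ℚ k K := IsScalarTower.of_algebraMap_eq fun q => by
    rw [RingHom.algebraMap_toAlgebra, eq_ratCast, eq_ratCast, map_ratCast]
  haveI : FiniteDimensional k K := FiniteDimensional.right ℚ k K
  have hkK : Module.finrank k K = 5 := by
    have h := Module.finrank_mul_finrank ℚ k K
    rw [h2, h10] at h
    omega
  have hcomm : ∀ f : K →ₐ[k] ℂ, f.toRingHom.comp i = τ := fun f =>
    RingHom.ext fun x => f.commutes x
  have hcomm' : ∀ s : {s : K →+* ℂ // s.comp i = τ}, ∀ x : k,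
      s.1.toFun (algebraMap k K x) = algebraMap k ℂ x := fun s x => RingHom.congr_fun s.2 x
  let eqv : (K →ₐ[k] ℂ) ≃ {s : K →+* ℂ // s.comp i = τ} :=
    { toFun := fun f => ⟨f.toRingHom, hcomm f⟩
      invFun := fun s => ⟨s.1, hcomm' s⟩
      left_inv := fun f => AlgHom.ext fun x => rfl
      right_inv := fun s => Subtype.ext (RingHom.ext fun x => rfl) }
  rw [← Fintype.card_subtype, ← Fintype.card_congr eqv, AlgHom.card, hkK]

end Fibre

/-! ## §2 The CM sixfold `B × E`: Weil type `(3,3)` from the type count -/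

section CM

open scoped Classical

variable {K : Type} [Field K] [NumberField K] {k : Type} [Field k] [NumberField k]

/-- **Weil type of the CM sixfold `B × E` from the TYPE COUNT** (Deligne 1982 §5 (c): a sum of CM types with constant
total gives Weil type).  For realisations `B ⊨ (K; Ψ)` (`[K:ℚ] = 10`), `E ⊨ (k; Φ₀)` (`[k:ℚ] = 2`), `i : k →+* K`,
`δ ∈ 𝓞_k` with `δ² = -d`, `0 < d`, `φ := ι_B(i δ) × ι_E(δ)` on `B × E`: if `#{s ∈ Ψ : s ∘ i = τ} + [τ ∈ Φ₀] = 3` for every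
`τ : k → ℂ`, then `(B × E, φ)` is of Weil type `(3, d)` — for `τ₊` with `τ₊(δ) = i√d`, the classes `fst^* v_s`
(`s ∘ i = τ₊`) and `snd^* u_{τ₊}` are six independent `i√d`-eigenvectors of `φ^*` whose Hodge types sum to `(3,3)`
(`WeilFourfold.isWeilType_of_cupPowOne`). [cite: Deligne1982HodgeCycles, §5 (c) and §4 Prop. 4.4]
[cite: vanGeemen1994HodgeAV, 4.9–4.10] -/
theorem isWeilType_cmFivefold_prod_cmCurve
    (h10 : Module.finrank ℚ K = 10) (h2 : Module.finrank ℚ k = 2) (i : k →+* K)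
    {Ψ : CMType K} {B : AbelianVariety ℂ} {ιB : 𝓞 K →+* End B} {θB : K →+* Module.End ℂ (complexBetti B.X 1)}
    (hB : IsCMTypeRealisation Ψ B ιB θB)
    {Φ₀ : CMType k} {E : AbelianVariety ℂ} {ιE : 𝓞 k →+* End E} {θE : k →+* Module.End ℂ (complexBetti E.X 1)}
    (hE : IsCMTypeRealisation Φ₀ E ιE θE)
    {δ : 𝓞 k} {d : ℕ} (hd : 0 < d) (hδ : ((δ : k)) ^ 2 = -(d : k))
    (hcount : ∀ τ : k →+* ℂ,
      (Finset.univ.filter fun s : K →+* ℂ => s.comp i = τ ∧ s ∈ Ψ.1).card + (if τ ∈ Φ₀.1 then 1 else 0) = 3) :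
    IsWeilType (B.prod E)
      (AbelianVariety.prodLift (AbelianVariety.fst B E ≫ ιB (RingOfIntegers.mapRingHom i δ))
        (AbelianVariety.snd B E ≫ ιE δ)) 3 d := by
  classical
  -- notation
  set δK : 𝓞 K := RingOfIntegers.mapRingHom i δ with hδKdef
  set φY : B.prod E ⟶ B.prod E :=
    AbelianVariety.prodLift (AbelianVariety.fst B E ≫ ιB δK) (AbelianVariety.snd B E ≫ ιE δ) with hφYdef
  set μ : ℂ := Complex.I * (Real.sqrt d : ℂ) with hμdef
  -- squares
  have hδ𝓞 : δ ^ 2 = -(d : 𝓞 k) := by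
    apply RingOfIntegers.ext
    change algebraMap (𝓞 k) k (δ ^ 2) = algebraMap (𝓞 k) k (-(d : 𝓞 k))
    rw [map_pow, map_neg, map_natCast]
    exact hδ
  have hδK : ((δK : K)) ^ 2 = -(d : K) := by
    rw [hδKdef, RingOfIntegers.mapRingHom_apply, ← map_pow, hδ, map_neg, map_natCast]
  have hδK𝓞 : δK ^ 2 = -(d : 𝓞 K) := by
    apply RingOfIntegers.ext
    change algebraMap (𝓞 K) K (δK ^ 2) = algebraMap (𝓞 K) K (-(d : 𝓞 K))
    rw [map_pow, map_neg, map_natCast]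
    exact hδK
  have hφY : φY ≫ φY = -(d • 𝟙 (B.prod E)) :=
    prodLift_comp_self_eq_neg_nsmul (comp_self_eq_neg_of_sq_eq_neg ιB hδK𝓞) (comp_self_eq_neg_of_sq_eq_neg ιE hδ𝓞)
  -- dimensions
  have hB5 : B.dim = 5 := by rw [dim_eq_of_isCMTypeRealisation hB, h10]
  have hE1 : E.dim = 1 := by rw [dim_eq_of_isCMTypeRealisation hE, h2]
  have hdim : (B.prod E).dim = 2 * 3 := by rw [AbelianVariety.dim_prod, hB5, hE1]
  have hY : IsSmoothProjective (2 * 3) (B.prod E).X := isSmoothProjective_of_dim_eq' hdim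
  -- eigenbases of the factors
  obtain ⟨v, hv⟩ := exists_eigenbasis hB
  obtain ⟨u, hu⟩ := exists_eigenbasis hE
  -- the embedding `τ₊` with `τ₊(δ) = i√d` and its five extensions
  obtain ⟨τ, hτ⟩ := exists_apply_eq_I_mul_sqrt hδ
  set F : Finset (K →+* ℂ) := Finset.univ.filter fun s : K →+* ℂ => s.comp i = τ with hFdef
  have hF : F.card = 5 := card_filter_comp_eq_five i h10 h2 τ
  let e : Fin 5 ≃ {s // s ∈ F} := (F.equivFinOfCardEq hF).symm
  let sF : Fin 5 → (K →+* ℂ) := fun m => (e m).1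
  have hsF : ∀ m, (sF m).comp i = τ := fun m => (Finset.mem_filter.mp (e m).2).2
  have hsF_inj : Function.Injective sF := Subtype.val_injective.comp e.injective
  -- the six eigenvectors
  let xB : Fin 5 → complexBetti (B.prod E).X 1 := fun m =>
    complexBetti.map (AbelianVariety.fst B E).hom.hom.hom 1 (v (sF m))
  let xE : complexBetti (B.prod E).X 1 := complexBetti.map (AbelianVariety.snd B E).hom.hom.hom 1 (u τ)
  let w : Fin 6 → complexBetti (B.prod E).X 1 := Fin.cons xE xB
  -- eigenvectors of `φ^*`
  have hvK : ∀ m, complexBetti.map (ιB δK).hom.hom.hom 1 (v (sF m)) = μ • v (sF m) := by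
    intro m
    rw [map_ι_apply_of_mem_eigenline hB (hv (sF m)) δK]
    congr 1
    rw [hδKdef, RingOfIntegers.mapRingHom_apply, ← RingHom.comp_apply, hsF m, hτ]
  have huk : complexBetti.map (ιE δ).hom.hom.hom 1 (u τ) = μ • u τ := by
    rw [map_ι_apply_of_mem_eigenline hE (hu τ) δ, hτ]
  have hw : ∀ j, w j ∈ Module.End.eigenspace (complexBetti.map φY.hom.hom.hom 1).hom μ := by
    intro j
    rw [Module.End.mem_eigenspace_iff]
    refine Fin.cases ?_ (fun m => ?_) j
    · change complexBetti.map φY.hom.hom.hom 1 xE = μ • xE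
      rw [hφYdef, map_prodLift_map_snd, huk, map_smul]
    · change complexBetti.map φY.hom.hom.hom 1 (xB m) = μ • xB m
      rw [hφYdef, map_prodLift_map_fst, hvK, map_smul]
  -- linear independence
  have hli : LinearIndependent ℂ w := by
    rw [Fintype.linearIndependent_iff]
    intro g hg
    rw [Fin.sum_univ_succ] at hg
    simp only [w, Fin.cons_zero, Fin.cons_succ] at hg
    -- project to `B` along the section `(𝟙, 0)`
    have h1 := congrArg (complexBetti.map (AbelianVariety.prodLift (𝟙 B) (0 : B ⟶ E)).hom.hom.hom 1) hg
    rw [map_add, map_smul, map_sum, map_zero, map_inlSection_map_snd_one, smul_zero, zero_add] at h1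
    have h1' : ∑ m : Fin 5, g m.succ • v (sF m) = 0 := by
      rw [← h1]
      refine Finset.sum_congr rfl fun m _ => ?_
      rw [map_smul, map_inlSection_map_fst_one]
    have hv5 : LinearIndependent ℂ (fun m : Fin 5 => v (sF m)) := v.linearIndependent.comp sF hsF_inj
    have hg' : ∀ m : Fin 5, g m.succ = 0 := Fintype.linearIndependent_iff.mp hv5 (fun m => g m.succ) h1'
    -- project to `E` along the section `(0, 𝟙)`
    have h2' := congrArg (complexBetti.map (AbelianVariety.prodLift (0 : E ⟶ B) (𝟙 E)).hom.hom.hom 1) hg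
    rw [map_add, map_smul, map_sum, map_zero, map_inrSection_map_snd_one] at h2'
    have hsum0 : ∑ m : Fin 5, complexBetti.map (AbelianVariety.prodLift (0 : E ⟶ B) (𝟙 E)).hom.hom.hom 1
        (g m.succ • xB m) = 0 :=
      Finset.sum_eq_zero fun m _ => by rw [map_smul, map_inrSection_map_fst_one, smul_zero]
    rw [hsum0, add_zero] at h2'
    have hg0 : g 0 = 0 := by
      rcases smul_eq_zero.mp h2' with h | h
      · exact h
      · exact absurd h (u.ne_zero τ)
    intro j
    exact Fin.cases hg0 hg' j
  -- Hodge types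
  let p : Fin 6 → ℕ := Fin.cons (if τ ∈ Φ₀.1 then 1 else 0) fun m => if sF m ∈ Ψ.1 then 1 else 0
  let q : Fin 6 → ℕ := Fin.cons (if τ ∈ Φ₀.1 then 0 else 1) fun m => if sF m ∈ Ψ.1 then 0 else 1
  have hpq : ∀ j, IsOfHodgeType (2 * 3) (B.prod E).X 1 (p j) (q j) (w j) := by
    intro j
    refine Fin.cases ?_ (fun m => ?_) j
    · change IsOfHodgeType (2 * 3) (B.prod E).X 1 (if τ ∈ Φ₀.1 then 1 else 0) (if τ ∈ Φ₀.1 then 0 else 1) xE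
      by_cases hτΦ : τ ∈ Φ₀.1
      · rw [if_pos hτΦ, if_pos hτΦ]
        exact (isOfHodgeType_oneZero_of_mem hE (hu τ) hτΦ).map_of_isSmoothProjective hY
          AbelianVariety.isSmoothProjective_holds _
      · rw [if_neg hτΦ, if_neg hτΦ]
        exact (isOfHodgeType_zeroOne_of_not_mem hE (hu τ) hτΦ).map_of_isSmoothProjective hY
          AbelianVariety.isSmoothProjective_holds _
    · change IsOfHodgeType (2 * 3) (B.prod E).X 1 (if sF m ∈ Ψ.1 then 1 else 0) (if sF m ∈ Ψ.1 then 0 else 1) (xB m)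
      by_cases hsΨ : sF m ∈ Ψ.1
      · rw [if_pos hsΨ, if_pos hsΨ]
        exact (isOfHodgeType_oneZero_of_mem hB (hv (sF m)) hsΨ).map_of_isSmoothProjective hY
          AbelianVariety.isSmoothProjective_holds _
      · rw [if_neg hsΨ, if_neg hsΨ]
        exact (isOfHodgeType_zeroOne_of_not_mem hB (hv (sF m)) hsΨ).map_of_isSmoothProjective hY
          AbelianVariety.isSmoothProjective_holds _
  -- the count
  have hsumB : ∑ m : Fin 5, (if sF m ∈ Ψ.1 then 1 else 0 : ℕ) =
      (Finset.univ.filter fun s : K →+* ℂ => s.comp i = τ ∧ s ∈ Ψ.1).card := by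
    have h1 : ∑ m : Fin 5, (if sF m ∈ Ψ.1 then 1 else 0 : ℕ) =
        ∑ s ∈ F, (if s ∈ Ψ.1 then 1 else 0 : ℕ) := by
      rw [← Finset.sum_coe_sort F, ← Fintype.sum_equiv e (fun m => (if sF m ∈ Ψ.1 then 1 else 0 : ℕ))
        (fun s => (if (s : K →+* ℂ) ∈ Ψ.1 then 1 else 0 : ℕ)) (fun m => rfl)]
    rw [h1, Finset.sum_boole, Nat.cast_id, hFdef, Finset.filter_filter]
  have hp : ∑ j, p j = 3 := by
    rw [Fin.sum_univ_succ]
    simp only [p, Fin.cons_zero, Fin.cons_succ]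
    rw [hsumB, add_comm]
    exact hcount τ
  have hpq1 : ∀ j, p j + q j = 1 := by
    intro j
    refine Fin.cases ?_ (fun m => ?_) j
    · change (if τ ∈ Φ₀.1 then 1 else 0) + (if τ ∈ Φ₀.1 then 0 else 1) = 1
      split_ifs <;> rfl
    · change (if sF m ∈ Ψ.1 then 1 else 0) + (if sF m ∈ Ψ.1 then 0 else 1) = 1
      split_ifs <;> rfl
  have hq : ∑ j, q j = 3 := by
    have h := Finset.sum_add_distrib (s := Finset.univ) (f := p) (g := q)
    rw [Finset.sum_congr rfl fun j _ => hpq1 j, Finset.sum_const, Finset.card_univ, Fintype.card_fin,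
      smul_eq_mul, mul_one, hp] at h
    omega
  exact isWeilType_of_cupPowOne φY (m := 3) three_pos hd hdim hφY w hli hw p q hpq hp hq

/-- **The whole Weil plane of the CM sixfold `B × E` is algebraic, GIVEN Markman's hyperbolic-sixfold theorem.**  In the
situation of `isWeilType_cmFivefold_prod_cmCurve`: `weilClassesOf (B × E) φ 3 d ≤ algebraicClasses (B × E).X 3`.  The
pointwise input is ring 2's `Ring2.AbelianAll.weilClasses_algebraic_fivefold_prod_curve_of_markmanSixfolds` (seat
ab-weil-2: `B × E`, an ODD-dimensional factor times a curve, is of SPLIT Weil type for a weighted Segre polarisation —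
the rescaling of Deligne LNM 900 §5 (c) / van Geemen 5.2–5.4 —, so Markman's Thm 1.5.1 applies DIRECTLY); Weil type
upgrades it to the complex plane (van Geemen 4.9).  CONDITIONAL on the UNREFEREED named fact
`Markman2025_weilClasses_algebraic_hyperbolicSixfold`; nothing else. [cite: Markman2025SecantWeil, Thm 1.5.1]
[cite: vanGeemen1994HodgeAV, 4.9, Lemma 5.2 (2)–(4) and (5.4.1)] [cite: MoonenZarhin1999LowDim, Thm. 0.1 (a)] -/
theorem weilClassesOf_le_algebraicClasses_cmFivefold_prod_cmCurve_of_markmanSixfold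
    (hM : Markman2025_weilClasses_algebraic_hyperbolicSixfold)
    (h10 : Module.finrank ℚ K = 10) (h2 : Module.finrank ℚ k = 2) (i : k →+* K)
    {Ψ : CMType K} {B : AbelianVariety ℂ} {ιB : 𝓞 K →+* End B} {θB : K →+* Module.End ℂ (complexBetti B.X 1)}
    (hB : IsCMTypeRealisation Ψ B ιB θB)
    {Φ₀ : CMType k} {E : AbelianVariety ℂ} {ιE : 𝓞 k →+* End E} {θE : k →+* Module.End ℂ (complexBetti E.X 1)}
    (hE : IsCMTypeRealisation Φ₀ E ιE θE)
    {δ : 𝓞 k} {d : ℕ} (hd : 0 < d) (hδ : ((δ : k)) ^ 2 = -(d : k))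
    (hcount : ∀ τ : k →+* ℂ,
      (Finset.univ.filter fun s : K →+* ℂ => s.comp i = τ ∧ s ∈ Ψ.1).card + (if τ ∈ Φ₀.1 then 1 else 0) = 3) :
    weilClassesOf (B.prod E)
      (AbelianVariety.prodLift (AbelianVariety.fst B E ≫ ιB (RingOfIntegers.mapRingHom i δ))
        (AbelianVariety.snd B E ≫ ιE δ)) 3 d ≤ algebraicClasses (B.prod E).X 3 := by
  have hδ𝓞 : δ ^ 2 = -(d : 𝓞 k) := by
    apply RingOfIntegers.ext
    change algebraMap (𝓞 k) k (δ ^ 2) = algebraMap (𝓞 k) k (-(d : 𝓞 k))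
    rw [map_pow, map_neg, map_natCast]
    exact hδ
  have hδK𝓞 : (RingOfIntegers.mapRingHom i δ) ^ 2 = -(d : 𝓞 K) := by
    rw [← map_pow, hδ𝓞, map_neg, map_natCast]
  have hWT := isWeilType_cmFivefold_prod_cmCurve h10 h2 i hB hE hd hδ hcount
  have hB5 : B.dim = 5 := by rw [dim_eq_of_isCMTypeRealisation hB, h10]
  have hE1 : E.dim = 1 := by rw [dim_eq_of_isCMTypeRealisation hE, h2]
  refine hWT.weilClassesOf_le_algebraicClasses fun c hcW hcQ hcH => ?_
  exact Summit.HodgeConjecture.HodgeConjecture.Ring2.AbelianAll.weilClasses_algebraic_fivefold_prod_curve_of_markmanSixfolds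
    hM hB5 hE1 hd (comp_self_eq_neg_of_sq_eq_neg ιB hδK𝓞) (comp_self_eq_neg_of_sq_eq_neg ιE hδ𝓞) hWT hcQ hcH hcW

end CM

end Summit.HodgeConjecture.CorCM.DecicCurveFivefold

end
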